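import Mathlib
import HarnessLib
import Summits.AtomisticToContinuum.FouriersLaw.Theses.JunctionLocality
import Summits.AtomisticToContinuum.FouriersLaw.Theses.BoundaryEscapeDeficit
import Summits.AtomisticToContinuum.FouriersLaw.Theorems.JunctionLocalitySuperadditiveResistanceStubPlainKuboLinkAux3

/-!
# Kubo link of line `ForecastSensitivitySketch` from `ResponseIdentity`
(stub `stub_kuboLink`, crux stmt-AtomisticToContinuum-11749, helper I — the CONDITIONAL form)

For the pinned anharmonic chain `pinnedChain ω₂ lam β γ` (all parameters `> 0`) and `T > 0`: along the crux's
unique weak steady-state family `μ` with response coefficients `D` at `T`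
(`totalCurrent(μ_{L,T+δ/2,T−δ/2})/δ → D_L` along `𝓝[≠] 0`), for every `L ≥ 2` and every classical mean-zero
`C² ∩ L²(μ_T)` forward field `g` of the LEFT bath (`L_{T,T} g = −(p_0² − T)` pointwise),

  `D_L/(L−1) = γ(1 − (γ/T²)⟨g, p_0² − T⟩_{μ_T})`

GIVEN the route item `BoundaryEscapeDeficit.ResponseIdentity` (stmt-AtomisticToContinuum-12237:
`totalCurrent(μ_{L,T+δ/2,T−δ/2})/δ → (L−1)·γ·E_L`, `E_L = 1 − (γ/T²)∫₀^∞ K_L`).  This is the sibling line's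
`kuboLink_of_responseIdentity` (crux 11748, `…StubPlainKuboLinkAux3`) with the idle positivity hypothesis
`∀ N ≥ 2, 0 < D N` dropped — that proof never used it: both `D_L` and `(L−1)γE_L` are limits of the same
difference quotient along the non-trivial filter `𝓝[≠] 0` (`tendsto_nhds_unique`), and
`⟨g, p_0² − T⟩_{μ_T} = ∫₀^∞ K_L` is the landed Green–Kubo identification `greenKubo_forwardField`.

References: Rey-Bellet 2003, Rem. 4.4 (finite-volume Kubo formula); Kundu–Dhar–Narayan 2009.
-/

noncomputable section

open MeasureTheory Filter Topology
open scoped ContDiff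
open Literature.MathematicalPhysics.KineticTheory.HeatConduction
open Summit.AtomisticToContinuum.FouriersLaw.Theorems.SuperadditiveResistance.DeviceLiouville (kin)
open Summit.AtomisticToContinuum.FouriersLaw.Cruxes.SuperadditiveResistance.FloatingProbeBypassLaplacian
  (greenKubo_forwardField)

namespace Summit.AtomisticToContinuum.FouriersLaw.Cruxes.ConductanceLowerBound.ForecastSensitivity

/-- **The Kubo link from `ResponseIdentity`** (stub `stub_kuboLink` of line `ForecastSensitivitySketch`,
conditional form): along the crux's unique weak steady-state family, for `L ≥ 2` and every classical mean-zero
`C² ∩ L²(μ_T)` forward field `g` of the left bath, `D_L/(L−1) = γ(1 − (γ/T²)⟨g, p_0² − T⟩_{μ_T})` — GIVEN the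
route item `BoundaryEscapeDeficit.ResponseIdentity` (stmt-AtomisticToContinuum-12237).  Both `D_L` and
`(L−1)·γ·E_L` are limits of the same difference quotient along the non-trivial filter `𝓝[≠] 0`, so they agree,
and `⟨g, p_0² − T⟩ = ∫₀^∞ K_L` by `greenKubo_forwardField`. -/
theorem stub_kuboLink_of_responseIdentity :
    Summit.AtomisticToContinuum.FouriersLaw.Theses.BoundaryEscapeDeficit.ResponseIdentity →
    ∀ (ω₂ lam β γ : ℝ) (μ : (N : ℕ) → ℝ → ℝ → Measure (PhaseSpace N)) (T : ℝ) (D : ℕ → ℝ),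
      0 < ω₂ → 0 < lam → 0 < β → 0 < γ → 0 < T →
      (∀ (N : ℕ) (T_L T_R : ℝ), 0 < T_L → 0 < T_R → ∀ ρ ρ' : Measure (PhaseSpace N),
        (pinnedChain ω₂ lam β γ).IsSteadyState N T_L T_R ρ →
        (pinnedChain ω₂ lam β γ).IsSteadyState N T_L T_R ρ' → ρ = ρ') →
      (∀ (N : ℕ) (T_L T_R : ℝ), 0 < T_L → 0 < T_R →
        (pinnedChain ω₂ lam β γ).IsSteadyState N T_L T_R (μ N T_L T_R)) →
      (∀ N : ℕ, Tendsto (fun δ : ℝ =>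
        (pinnedChain ω₂ lam β γ).totalCurrent (μ N (T + δ / 2) (T - δ / 2)) / δ) (𝓝[≠] 0) (𝓝 (D N))) →
      ∀ L : ℕ, 2 ≤ L → ∀ g : PhaseSpace L → ℝ, ContDiff ℝ 2 g →
        MemLp g 2 ((pinnedChain ω₂ lam β γ).gibbsMeasure L T) →
        ∫ x, g x ∂((pinnedChain ω₂ lam β γ).gibbsMeasure L T) = 0 →
        (∀ x, (pinnedChain ω₂ lam β γ).generator L T T g x = -(kin L 0 x - T)) →
        D L / ((L : ℝ) - 1) =
          γ * (1 - γ / T ^ 2 * ∫ x, g x * (kin L 0 x - T) ∂((pinnedChain ω₂ lam β γ).gibbsMeasure L T)) := by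
  -- adapted from `kuboLink_of_responseIdentity` (…StubPlainKuboLinkAux3), positivity hypothesis dropped
  intro hRI ω₂ lam β γ μ T D hω hl hβ hγ hT hU hμ hD L hL2 g hC hgL2 hmean hpde
  have hL : 0 < L := by omega
  -- `ResponseIdentity` for this family at this `L`
  have hri := hRI ω₂ lam β γ hω hl hβ hγ hU μ hμ T hT
  dsimp only at hri
  obtain ⟨-, hlim⟩ := hri L hL
  simp only [dif_pos hL] at hlim
  -- uniqueness of the limit along `𝓝[≠] 0`
  have hDL := tendsto_nhds_unique (hD L) hlim
  rw [hDL, greenKubo_forwardField hω hl.le hβ hγ hL hT hC hgL2 hmean hpde]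
  have hL1 : ((L : ℝ) - 1) ≠ 0 := by
    have : (2 : ℝ) ≤ (L : ℝ) := by exact_mod_cast hL2
    linarith
  field_simp

end Summit.AtomisticToContinuum.FouriersLaw.Cruxes.ConductanceLowerBound.ForecastSensitivity

end
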